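/-
Copyright (c) 2026. All rights reserved.
Released under Apache 2.0 license as described in the file LICENSE.
-/
import Summits.CriticalPhenomena.LaceExpansionHighD.NobleBoundsNResidualSharpTargets
import HarnessLib

/-!
# Fitzner–van der Hofstad (2017), Prop. 5.5 (5.34) at `N = M + 2` against the SHARP blocks, hypothesis-free — Part
III §E–§F: `pkg` at every junction, the class estimate `h2` with SHARP targets, and [FvdH17] Prop. 5.5 (5.34) at `N
= M + 2` against the SHARP blocks from per-pair packages and modulo the six Sharp slots
(`tsum_nobleXiT_le_secStarBSharp_of_sharpSlots`; twin of `NobleBoundsNResidualB` §C–§D) (WHAT-IF, DIVERGENCE D77;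
b2b-lace LEMMAS node N76-X2-D77, module 8/11)

[FvdH17] = R. Fitzner, R. van der Hofstad, *Mean-field behavior for nearest-neighbor percolation in `d > 10`*,
arXiv:1506.07977v2 (EJP 22 (2017), paper 43).  Page numbers refer to the arXiv version.

SPLIT PROVENANCE: module 8 of 11 of the b2b-lace node N76-X2-D77 (what-if, DIVERGENCE D77) — the 11 modules are the
section-seam split (carver-g217, 2026-08-27) of the single-module form `NobleBoundsNSharpD77.lean` (carver-g51
text-final, sha256 `877e12977f9f9c92`, 2707 lines): every declaration, statement and proof is carried over verbatim and
in the original order; only module boundaries, the repeated `section`/`variable` headers and two docstrings were added.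
PLACEMENT: what-if objects of `NobleBlocksSharp` (b2b-lace LEAN PLACEMENT RULE, REFEREE R491), hence
`namespace Summit.CriticalPhenomena.LaceExpansionHighD.NobleBlocks`.  Conventions: `d`-generic; every declaration
carries its [FvdH17] display / page cite in the docstring; NOTHING is cited as a fact (b2b-lace ABSOLUTE RULE);
additive (no existing declaration is changed). -/

noncomputable section

namespace Summit.CriticalPhenomena.LaceExpansionHighD.NobleBlocks

open Literature.Probability.FitznerVanDerHofstad2017 Literature.Probability.FitznerVanDerHofstad2017.NobleBlocks
open Literature.Probability.FitznerVanDerHofstad2017.NobleBlocks.LenIdx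
open Literature.Probability.LatticeModels Literature.Probability.Percolation
open Literature.Probability.FitznerVanDerHofstad2017.BlockSummation
open Literature.Barriers.CriticalPhenomena
open Literature.Combinatorics.SimpleGraph _root_.SimpleGraph _root_.MeasureTheory
open scoped BigOperators ENNReal Matrix

variable {d : ℕ}

section DispatchS

variable (p : unitInterval) (M : ℕ) (x : Site d) (b : Fin (M + 2) → Site d × Site d) (w t z : Fin (M + 2) → Site d)
  (a : Fin (M + 2) → Fin 3 ⊕ Unit) (c : Fin 3 ⊕ Unit) (τ : Fin (M + 1) → Bool × Fin 3)

/-! ### §E. `pkg` at every junction and the class estimate `h2`, SHARP targets (twins of ResidualB §C/§D) -/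

/-- **`pkg` from per-pair packages, SHARP targets**: `nonempty_jPkg_allB` with `tgtRegS` / `tgtStarLS` in the three
per-pair families; the regular/`★`, `★★`, closed-first-level and last-junction cases are the landed ones.
[cite: FitznerVanDerHofstad2017, §6.1 (6.4) and "Case b = 0 / 1 / ≥ 2" (arXiv:1506.07977v2 pp. 58–59); §5.1 (5.4) (p. 48); (4.57)–(4.64) (pp. 41–42)] -/
theorem nonempty_jPkg_allS (κ : Fin (M + 2) → Fin d × Bool) (hκ : ∀ i, (b i).2 = (b i).1 + stepVec (κ i))
    (hτ : AdmT M a τ)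
    (hFR : ∀ a₀ a' : Fin 3, a (0 : Fin (M + 1)).castSucc = Sum.inl a₀ → a (0 : Fin (M + 1)).succ = Sum.inl a' →
      Nonempty (JPkg p (jctx M x b w t z a τ (0 : Fin (M + 1)).castSucc) (JFacts M x b w t z a c τ)
        (blockPS (Letters.perc d p) a₀ (b (0 : Fin (M + 1)).castSucc).1 (w (0 : Fin (M + 1)).castSucc) *
          tgtRegS (Letters.perc d p) (κ (0 : Fin (M + 1)).castSucc) a₀ a' (b (0 : Fin (M + 1)).castSucc).1
            (w (0 : Fin (M + 1)).castSucc) (t (0 : Fin (M + 1)).castSucc) (z (0 : Fin (M + 1)).castSucc)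
            (w (0 : Fin (M + 1)).succ) (b (0 : Fin (M + 1)).succ).1 (τ 0))))
    (hMR : ∀ i i₀ : Fin (M + 1), i₀.succ = i.castSucc → ∀ a₀ a' : Fin 3, a i.castSucc = Sum.inl a₀ →
      a i.succ = Sum.inl a' →
      Nonempty (JPkg p (jctx M x b w t z a τ i.castSucc) (JFacts M x b w t z a c τ)
        (tgtRegS (Letters.perc d p) (κ i.castSucc) a₀ a' (b i.castSucc).1 (w i.castSucc) (t i.castSucc) (z i.castSucc)
          (w i.succ) (b i.succ).1 (τ i))))
    (hML : ∀ i i₀ : Fin (M + 1), i₀.succ = i.castSucc → ∀ (u₀ : Unit) (a' : Fin 3), a i.castSucc = Sum.inr u₀ →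
      a i.succ = Sum.inl a' →
      Nonempty (JPkg p (jctx M x b w t z a τ i.castSucc) (JFacts M x b w t z a c τ)
        (tgtStarLS (Letters.perc d p) (κ i.castSucc) a' (b i.castSucc).1 (w i.castSucc) (t i.castSucc) (z i.castSucc)
          (w i.succ) (b i.succ).1 (τ i)))) :
    ∀ k, Nonempty (JPkg p (jctx M x b w t z a τ k) (JFacts M x b w t z a c τ)
      (jTarget M (tgtAllS (Letters.perc d p) M a b w t z κ) (tgtLast (Letters.perc d p) M x a c b w t z κ) τ k)) := by
  intro k
  induction k using Fin.lastCases with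
  | last =>
      simp only [jTarget, Fin.lastCases_last]
      exact nonempty_jPkg_end_starA p M x b w t z a c τ (κ _) (hκ _)
  | cast i =>
      simp only [jTarget, Fin.lastCases_castSucc]
      have hσ : ∀ u₁ : Unit, a i.succ = Sum.inr u₁ → (τ i).1 = false := fun u₁ h => hτ i (by rw [h]; rfl)
      rcases Fin.eq_zero_or_eq_succ i with rfl | ⟨j, rfl⟩
      · rw [tgtAllS, if_pos rfl]
        rcases ha : a (0 : Fin (M + 1)).castSucc with a₀ | u₀
        · rcases ha' : a (0 : Fin (M + 1)).succ with a' | u₁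
          · rw [starS_inl, tgtJS_inl_inl]
            exact hFR a₀ a' ha ha'
          · rw [starS_inl, tgtJS_inl_inr]
            exact nonempty_jPkg_first_starU p M x b w t z a c τ (κ _) (hκ _) a₀ ha ha' (hσ u₁ ha')
        · exact nonempty_jPkg_of_closed_zero p M x b w t z a c τ ha _ _
      · rw [tgtAllS, if_neg (Fin.succ_ne_zero j), one_mul]
        have hk : (j.castSucc).succ = (j.succ).castSucc := Fin.succ_castSucc j
        rcases ha : a j.succ.castSucc with a₀ | u₀
        · rcases ha' : a j.succ.succ with a' | u₁
          · rw [tgtJS_inl_inl]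
            exact hMR _ _ hk a₀ a' ha ha'
          · rw [tgtJS_inl_inr]
            exact nonempty_jPkg_mid_starU p M x b w t z a c τ _ _ hk (κ _) (hκ _) a₀ ha ha' (hσ u₁ ha')
        · rcases ha' : a j.succ.succ with a' | u₁
          · rw [tgtJS_inr_inl]
            exact hML _ _ hk u₀ a' ha ha'
          · rw [tgtJS_inr_inr]
            by_cases hs : z j.succ.castSucc = w j.succ.castSucc ∧ w j.succ.succ = (b j.succ.castSucc).1
            · exact nonempty_jPkg_mid_starStar p M x b w t z a c τ _ _ hk (κ _) (hκ _) ha ha' hs.1 hs.2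
            · exact nonempty_jPkg_starStar_of_ne p M x b w t z a c τ _ _ hk ha ha' (not_and_or.mp hs) _

/-- **`pkg` AT EVERY JUNCTION FROM THE SIX SHARP SLOTS**: `nonempty_jPkg_allS` with its three per-pair families
supplied by the re-dispatchers of §D.  What remains: the Sharp-target packages on R′ / R at the first pair
(`hR'₀`, `hR₀`), at the middle regular pairs (`hR'`, `hR`) and over a closed lower level (`hR'L`, `hRL`).
[cite: FitznerVanDerHofstad2017, §6.1 (6.4), "Case b = 0 / 1 / ≥ 2" and the coincidence cases `w' = t`, `z = t` (arXiv:1506.07977v2 pp. 58–59); App. B (pp. 75–76); §5.1 (5.4) (p. 48); §4.4 (4.64) (p. 42)] -/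
theorem nonempty_jPkg_all_of_sharpSlots (κ : Fin (M + 2) → Fin d × Bool) (hκ : ∀ i, (b i).2 = (b i).1 + stepVec (κ i))
    (hτ : AdmT M a τ)
    (hR'₀ : ∀ a₀ a' : Fin 3, a (0 : Fin (M + 1)).castSucc = Sum.inl a₀ → a (0 : Fin (M + 1)).succ = Sum.inl a' →
      (τ 0).1 = false → a' ≠ 0 → w (0 : Fin (M + 1)).succ = t (0 : Fin (M + 1)).castSucc →
      Nonempty (JPkg p (jctx M x b w t z a τ (0 : Fin (M + 1)).castSucc) (JFacts M x b w t z a c τ)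
        (blockPS (Letters.perc d p) a₀ (b (0 : Fin (M + 1)).castSucc).1 (w (0 : Fin (M + 1)).castSucc) *
          tgtRegS (Letters.perc d p) (κ (0 : Fin (M + 1)).castSucc) a₀ a' (b (0 : Fin (M + 1)).castSucc).1
            (w (0 : Fin (M + 1)).castSucc) (t (0 : Fin (M + 1)).castSucc) (z (0 : Fin (M + 1)).castSucc)
            (w (0 : Fin (M + 1)).succ) (b (0 : Fin (M + 1)).succ).1 (τ 0))))
    (hR₀ : ∀ a₀ a' : Fin 3, a (0 : Fin (M + 1)).castSucc = Sum.inl a₀ → a (0 : Fin (M + 1)).succ = Sum.inl a' →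
      τ 0 = (true, 0) → a' = 2 → t (0 : Fin (M + 1)).castSucc ≠ (b (0 : Fin (M + 1)).succ).1 →
      z (0 : Fin (M + 1)).castSucc = t (0 : Fin (M + 1)).castSucc →
      (zdGraph d).Adj (w (0 : Fin (M + 1)).succ) (t (0 : Fin (M + 1)).castSucc) →
      Nonempty (JPkg p (jctx M x b w t z a τ (0 : Fin (M + 1)).castSucc) (JFacts M x b w t z a c τ)
        (blockPS (Letters.perc d p) a₀ (b (0 : Fin (M + 1)).castSucc).1 (w (0 : Fin (M + 1)).castSucc) *
          tgtRegS (Letters.perc d p) (κ (0 : Fin (M + 1)).castSucc) a₀ a' (b (0 : Fin (M + 1)).castSucc).1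
            (w (0 : Fin (M + 1)).castSucc) (t (0 : Fin (M + 1)).castSucc) (z (0 : Fin (M + 1)).castSucc)
            (w (0 : Fin (M + 1)).succ) (b (0 : Fin (M + 1)).succ).1 (τ 0))))
    (hR' : ∀ i i₀ : Fin (M + 1), i₀.succ = i.castSucc → ∀ a₀ a' : Fin 3, a i.castSucc = Sum.inl a₀ →
      a i.succ = Sum.inl a' → (τ i).1 = false → a' ≠ 0 → w i.succ = t i.castSucc →
      Nonempty (JPkg p (jctx M x b w t z a τ i.castSucc) (JFacts M x b w t z a c τ)
        (tgtRegS (Letters.perc d p) (κ i.castSucc) a₀ a' (b i.castSucc).1 (w i.castSucc) (t i.castSucc) (z i.castSucc)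
          (w i.succ) (b i.succ).1 (τ i))))
    (hR : ∀ i i₀ : Fin (M + 1), i₀.succ = i.castSucc → ∀ a₀ a' : Fin 3, a i.castSucc = Sum.inl a₀ →
      a i.succ = Sum.inl a' → τ i = (true, 0) → a' = 2 → t i.castSucc ≠ (b i.succ).1 →
      z i.castSucc = t i.castSucc → (zdGraph d).Adj (w i.succ) (t i.castSucc) →
      Nonempty (JPkg p (jctx M x b w t z a τ i.castSucc) (JFacts M x b w t z a c τ)
        (tgtRegS (Letters.perc d p) (κ i.castSucc) a₀ a' (b i.castSucc).1 (w i.castSucc) (t i.castSucc) (z i.castSucc)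
          (w i.succ) (b i.succ).1 (τ i))))
    (hR'L : ∀ i i₀ : Fin (M + 1), i₀.succ = i.castSucc → ∀ (u₀ : Unit) (a' : Fin 3), a i.castSucc = Sum.inr u₀ →
      a i.succ = Sum.inl a' → (τ i).1 = false → a' ≠ 0 → w i.succ = t i.castSucc →
      Nonempty (JPkg p (jctx M x b w t z a τ i.castSucc) (JFacts M x b w t z a c τ)
        (tgtStarLS (Letters.perc d p) (κ i.castSucc) a' (b i.castSucc).1 (w i.castSucc) (t i.castSucc) (z i.castSucc)
          (w i.succ) (b i.succ).1 (τ i))))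
    (hRL : ∀ i i₀ : Fin (M + 1), i₀.succ = i.castSucc → ∀ (u₀ : Unit) (a' : Fin 3), a i.castSucc = Sum.inr u₀ →
      a i.succ = Sum.inl a' → (τ i).1 = true → (τ i).2 = 0 → a' = 2 → t i.castSucc ≠ (b i.succ).1 →
      z i.castSucc = t i.castSucc → z i.castSucc = w i.castSucc → (zdGraph d).Adj (w i.succ) (t i.castSucc) →
      Nonempty (JPkg p (jctx M x b w t z a τ i.castSucc) (JFacts M x b w t z a c τ)
        (tgtStarLS (Letters.perc d p) (κ i.castSucc) a' (b i.castSucc).1 (w i.castSucc) (t i.castSucc) (z i.castSucc)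
          (w i.succ) (b i.succ).1 (τ i)))) :
    ∀ k, Nonempty (JPkg p (jctx M x b w t z a τ k) (JFacts M x b w t z a c τ)
      (jTarget M (tgtAllS (Letters.perc d p) M a b w t z κ) (tgtLast (Letters.perc d p) M x a c b w t z κ) τ k)) :=
  nonempty_jPkg_allS p M x b w t z a c τ κ hκ hτ
    (fun a₀ a' ha ha' => nonempty_jPkg_first_regS p M x b w t z a c τ (κ _) (hκ _) a₀ a' ha ha'
      (hR'₀ a₀ a' ha ha') (hR₀ a₀ a' ha ha'))
    (fun i i₀ hk a₀ a' ha ha' => nonempty_jPkg_mid_regS p M x b w t z a c τ i i₀ hk (κ _) (hκ _) a₀ a' ha ha'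
      (hR' i i₀ hk a₀ a' ha ha') (hR i i₀ hk a₀ a' ha ha'))
    fun i i₀ hk u₀ a' ha ha' => nonempty_jPkg_mid_starLS p M x b w t z a c τ i i₀ hk (κ _) (hκ _) ha a' ha'
      (hR'L i i₀ hk u₀ a' ha ha') (hRL i i₀ hk u₀ a' ha ha')

end DispatchS

section ClassEstimateS

variable (p : unitInterval) (M : ℕ) (x : Site d)

/-- **THE CLASS ESTIMATE `h2` FROM PER-PAIR JUNCTION PACKAGES, SHARP targets** (twin of
`prod_bondJ_mul_piPerc_jwCover_le_secStarB_of_pairPackages` at `X := blockXSharp 𝐋`).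
[cite: FitznerVanDerHofstad2017, §6.1 (6.4) pp. 58–59, §6.2.1 (6.48)–(6.51) pp. 65–67, §5.1 (5.4) p. 48, App. B pp. 74–78 (arXiv:1506.07977v2); §4.4 (4.64) (p. 42)] -/
theorem prod_bondJ_mul_piPerc_jwCover_le_secStarBSharp_of_pairPackages
    (a : Fin (M + 2) → Fin 3 ⊕ Unit) (c : Fin 3 ⊕ Unit) (b : Fin (M + 2) → Site d × Site d)
    (w t z : Fin (M + 2) → Site d)
    (hFR : ∀ κ : Fin (M + 2) → Fin d × Bool, (∀ i, (b i).2 = (b i).1 + stepVec (κ i)) →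
      ∀ τ : Fin (M + 1) → Bool × Fin 3, AdmT M a τ →
      ∀ a₀ a' : Fin 3, a (0 : Fin (M + 1)).castSucc = Sum.inl a₀ → a (0 : Fin (M + 1)).succ = Sum.inl a' →
      Nonempty (JPkg p (jctx M x b w t z a τ (0 : Fin (M + 1)).castSucc) (JFacts M x b w t z a c τ)
        (blockPS (Letters.perc d p) a₀ (b (0 : Fin (M + 1)).castSucc).1 (w (0 : Fin (M + 1)).castSucc) *
          tgtRegS (Letters.perc d p) (κ (0 : Fin (M + 1)).castSucc) a₀ a' (b (0 : Fin (M + 1)).castSucc).1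
            (w (0 : Fin (M + 1)).castSucc) (t (0 : Fin (M + 1)).castSucc) (z (0 : Fin (M + 1)).castSucc)
            (w (0 : Fin (M + 1)).succ) (b (0 : Fin (M + 1)).succ).1 (τ 0))))
    (hMR : ∀ κ : Fin (M + 2) → Fin d × Bool, (∀ i, (b i).2 = (b i).1 + stepVec (κ i)) →
      ∀ τ : Fin (M + 1) → Bool × Fin 3, AdmT M a τ →
      ∀ i i₀ : Fin (M + 1), i₀.succ = i.castSucc → ∀ a₀ a' : Fin 3, a i.castSucc = Sum.inl a₀ →
      a i.succ = Sum.inl a' →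
      Nonempty (JPkg p (jctx M x b w t z a τ i.castSucc) (JFacts M x b w t z a c τ)
        (tgtRegS (Letters.perc d p) (κ i.castSucc) a₀ a' (b i.castSucc).1 (w i.castSucc) (t i.castSucc) (z i.castSucc)
          (w i.succ) (b i.succ).1 (τ i))))
    (hML : ∀ κ : Fin (M + 2) → Fin d × Bool, (∀ i, (b i).2 = (b i).1 + stepVec (κ i)) →
      ∀ τ : Fin (M + 1) → Bool × Fin 3, AdmT M a τ →
      ∀ i i₀ : Fin (M + 1), i₀.succ = i.castSucc → ∀ (u₀ : Unit) (a' : Fin 3), a i.castSucc = Sum.inr u₀ →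
      a i.succ = Sum.inl a' →
      Nonempty (JPkg p (jctx M x b w t z a τ i.castSucc) (JFacts M x b w t z a c τ)
        (tgtStarLS (Letters.perc d p) (κ i.castSucc) a' (b i.castSucc).1 (w i.castSucc) (t i.castSucc) (z i.castSucc)
          (w i.succ) (b i.succ).1 (τ i)))) :
    (∏ i, ENNReal.ofReal (bondJ d p ((b i).2 - (b i).1))) *
        piPerc d p (M + 3) (jwCoverE M x b w t z ∩ jwCoverC M x b w t z a c) ≤
      ∑ κ : Fin (M + 2) → Fin d × Bool, dirInd stepVec κ b *
        (starS (blockPS (Letters.perc d p)) (a 0) (b 0).1 (w 0) *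
          chainTail (secStarBpt (blockBFullptB' (Letters.perc d p) (blockXSharp (Letters.perc d p))) 2 0)
            (starA (blockAbar' (Letters.perc d p)) (secEA (blockAbar' (Letters.perc d p)) 2))
            (starS (blockPE (Letters.perc d p))) x (M + 1) κ a c b w t z) :=
  prod_bondJ_mul_piPerc_jwCover_le_chain_of_packages p M x (starS (blockPS (Letters.perc d p)))
    (secStarBpt (blockBFullptB' (Letters.perc d p) (blockXSharp (Letters.perc d p))) 2 0)
    (starA (blockAbar' (Letters.perc d p)) (secEA (blockAbar' (Letters.perc d p)) 2)) (starS (blockPE (Letters.perc d p)))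
    a c b w t z (tgtAllS (Letters.perc d p) M a b w t z) (tgtLast (Letters.perc d p) M x a c b w t z)
    (fun κ hκ τ hτ => nonempty_jPkg_allS p M x b w t z a c τ κ hκ hτ (hFR κ hκ τ hτ) (hMR κ hκ τ hτ) (hML κ hκ τ hτ))
    (fun κ _ i => sum_filter_tgtAllS_le (Letters.perc d p) M a b w t z κ i) fun _ _ => le_rfl

end ClassEstimateS

/-! ### §F. (5.34) at `N = M + 2` against the SHARP blocks: from per-pair packages, and from the six SHARP slots -/

section SizeModelS

variable (p : unitInterval) (M : ℕ)

/-- **(5.34) AT `N = M + 2` FROM PER-PAIR JUNCTION PACKAGES, SHARP targets and SHARP blocks**: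
`Σ_x Ξ̂^{(M+2)}(x) ≤ (P^S)ᵗ · B♯_sec^{M+1} · Ā_sec · P^E` over `Fin 3 ⊕ Unit` with the regular block
`blockBFullB' 𝐋 (blockX₂Sharp 𝐋)` and the `★` families of `blockBFullpt' 𝐋 (blockXSharp 𝐋)` — the generic-`X` cover
theorem `tsum_nobleXiT_le_secStarB'_of_cover` at `X := blockXSharp 𝐋`, `X₂ := blockX₂Sharp 𝐋`
(`tsum_tsum_blockXSharp`, `isTransInv_blockX₂Sharp`, `isTransInv₆_blockXSharp`).
[cite: FitznerVanDerHofstad2017, Prop. 5.5 (5.34) (arXiv:1506.07977v2 p. 53); §5.1 (5.4) (p. 48) and "Elements of the bounds" (p. 49); §6.1 (6.4) (pp. 58–59); Lemma 6.1, §6.2.1 (6.48)–(6.51) (pp. 65–67); §4.4 (4.64) (p. 42)] -/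
theorem tsum_nobleXiT_le_secStarBSharp_of_pairPackages
    (hFR : ∀ (x : Site d) (a : Fin (M + 2) → Fin 3 ⊕ Unit) (c : Fin 3 ⊕ Unit) (b : Fin (M + 2) → Site d × Site d)
      (w t z : Fin (M + 2) → Site d),
      ∀ κ : Fin (M + 2) → Fin d × Bool, (∀ i, (b i).2 = (b i).1 + stepVec (κ i)) →
      ∀ τ : Fin (M + 1) → Bool × Fin 3, AdmT M a τ →
      ∀ a₀ a' : Fin 3, a (0 : Fin (M + 1)).castSucc = Sum.inl a₀ → a (0 : Fin (M + 1)).succ = Sum.inl a' →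
      Nonempty (JPkg p (jctx M x b w t z a τ (0 : Fin (M + 1)).castSucc) (JFacts M x b w t z a c τ)
        (blockPS (Letters.perc d p) a₀ (b (0 : Fin (M + 1)).castSucc).1 (w (0 : Fin (M + 1)).castSucc) *
          tgtRegS (Letters.perc d p) (κ (0 : Fin (M + 1)).castSucc) a₀ a' (b (0 : Fin (M + 1)).castSucc).1
            (w (0 : Fin (M + 1)).castSucc) (t (0 : Fin (M + 1)).castSucc) (z (0 : Fin (M + 1)).castSucc)
            (w (0 : Fin (M + 1)).succ) (b (0 : Fin (M + 1)).succ).1 (τ 0))))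
    (hMR : ∀ (x : Site d) (a : Fin (M + 2) → Fin 3 ⊕ Unit) (c : Fin 3 ⊕ Unit) (b : Fin (M + 2) → Site d × Site d)
      (w t z : Fin (M + 2) → Site d),
      ∀ κ : Fin (M + 2) → Fin d × Bool, (∀ i, (b i).2 = (b i).1 + stepVec (κ i)) →
      ∀ τ : Fin (M + 1) → Bool × Fin 3, AdmT M a τ →
      ∀ i i₀ : Fin (M + 1), i₀.succ = i.castSucc → ∀ a₀ a' : Fin 3, a i.castSucc = Sum.inl a₀ →
      a i.succ = Sum.inl a' →
      Nonempty (JPkg p (jctx M x b w t z a τ i.castSucc) (JFacts M x b w t z a c τ)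
        (tgtRegS (Letters.perc d p) (κ i.castSucc) a₀ a' (b i.castSucc).1 (w i.castSucc) (t i.castSucc) (z i.castSucc)
          (w i.succ) (b i.succ).1 (τ i))))
    (hML : ∀ (x : Site d) (a : Fin (M + 2) → Fin 3 ⊕ Unit) (c : Fin 3 ⊕ Unit) (b : Fin (M + 2) → Site d × Site d)
      (w t z : Fin (M + 2) → Site d),
      ∀ κ : Fin (M + 2) → Fin d × Bool, (∀ i, (b i).2 = (b i).1 + stepVec (κ i)) →
      ∀ τ : Fin (M + 1) → Bool × Fin 3, AdmT M a τ →
      ∀ i i₀ : Fin (M + 1), i₀.succ = i.castSucc → ∀ (u₀ : Unit) (a' : Fin 3), a i.castSucc = Sum.inr u₀ →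
      a i.succ = Sum.inl a' →
      Nonempty (JPkg p (jctx M x b w t z a τ i.castSucc) (JFacts M x b w t z a c τ)
        (tgtStarLS (Letters.perc d p) (κ i.castSucc) a' (b i.castSucc).1 (w i.castSucc) (t i.castSucc) (z i.castSucc)
          (w i.succ) (b i.succ).1 (τ i)))) :
    ∑' x, nobleXiT d p (M + 2) x ≤
      vecP (starS (blockPS (Letters.perc d p))) ᵥ*
        matB (starB (blockBFullB' (Letters.perc d p) (blockX₂Sharp (Letters.perc d p)))
          (secEc (blockBFullpt' (Letters.perc d p) (blockXSharp (Letters.perc d p))) 0)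
          (secEo (blockBFullpt' (Letters.perc d p) (blockXSharp (Letters.perc d p))) 2)
          (secEoc (blockBFullpt' (Letters.perc d p) (blockXSharp (Letters.perc d p))) 2 0)) ^ (M + 1) ᵥ*
          matAbar (starA (blockAbar' (Letters.perc d p)) (secEA (blockAbar' (Letters.perc d p)) 2)) ⬝ᵥ
        vecP (starS (blockPE (Letters.perc d p))) :=
  tsum_nobleXiT_le_secStarB'_of_cover p (M + 1) (blockXSharp (Letters.perc d p)) (blockX₂Sharp (Letters.perc d p))
    (fun κ a a' u w w' u' => tsum_tsum_blockXSharp (Letters.perc d p) κ a a' u w w' u')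
    (fun ι a b => isTransInv_blockX₂Sharp (Letters.perc d p) ι a b)
    (fun κ a a' => isTransInv₆_blockXSharp (Letters.perc d p) κ a a')
    (fun x b w t z => jwCoverE M x b w t z) (fun x b w t z a c => jwCoverC M x b w t z a c)
    (fun x => jwCoverE_subset_iUnion_jwCoverC M x) (fun x => nobleXiT_succ_succ_le_jwCoverE p M x)
    fun x a c b w t z => prod_bondJ_mul_piPerc_jwCover_le_secStarBSharp_of_pairPackages p M x a c b w t z
      (hFR x a c b w t z) (hMR x a c b w t z) (hML x a c b w t z)

/-- **(5.34) AT `N = M + 2` AGAINST THE SHARP BLOCKS, MODULO THE SIX SHARP SLOTS**: granted, at every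
`(x, a, c, b⃗, w⃗, t⃗, z⃗)`, direction assignment `κ` and admissible `τ`, the Sharp-target packages on the corner
`R′` and the cut-through `R` at the first pair (`hR'₀`, `hR₀`), at the middle regular pairs (`hR'`, `hR`) and over a
closed lower level (`hR'L`, `hRL`) — the conditions of the slots are VERBATIM those of
`tsum_nobleXiT_le_secStarB'_of_residuals`, only the targets are the Sharp ones (`tgtRegS`, `tgtStarLS`).
[cite: FitznerVanDerHofstad2017, Prop. 5.5 (5.34) (arXiv:1506.07977v2 p. 53); §5.1 (5.4) (p. 48) and "Elements of the bounds" (p. 49); §6.1 (6.4) (pp. 58–59); Lemma 6.1, §6.2.1 (6.48)–(6.51) (pp. 65–67); §4.4 (4.64) (p. 42)] -/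
theorem tsum_nobleXiT_le_secStarBSharp_of_sharpSlots
    (hR'₀ : ∀ (x : Site d) (a : Fin (M + 2) → Fin 3 ⊕ Unit) (c : Fin 3 ⊕ Unit) (b : Fin (M + 2) → Site d × Site d)
      (w t z : Fin (M + 2) → Site d),
      ∀ κ : Fin (M + 2) → Fin d × Bool, (∀ i, (b i).2 = (b i).1 + stepVec (κ i)) →
      ∀ τ : Fin (M + 1) → Bool × Fin 3, AdmT M a τ →
      ∀ a₀ a' : Fin 3, a (0 : Fin (M + 1)).castSucc = Sum.inl a₀ → a (0 : Fin (M + 1)).succ = Sum.inl a' →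
      (τ 0).1 = false → a' ≠ 0 → w (0 : Fin (M + 1)).succ = t (0 : Fin (M + 1)).castSucc →
      Nonempty (JPkg p (jctx M x b w t z a τ (0 : Fin (M + 1)).castSucc) (JFacts M x b w t z a c τ)
        (blockPS (Letters.perc d p) a₀ (b (0 : Fin (M + 1)).castSucc).1 (w (0 : Fin (M + 1)).castSucc) *
          tgtRegS (Letters.perc d p) (κ (0 : Fin (M + 1)).castSucc) a₀ a' (b (0 : Fin (M + 1)).castSucc).1
            (w (0 : Fin (M + 1)).castSucc) (t (0 : Fin (M + 1)).castSucc) (z (0 : Fin (M + 1)).castSucc)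
            (w (0 : Fin (M + 1)).succ) (b (0 : Fin (M + 1)).succ).1 (τ 0))))
    (hR₀ : ∀ (x : Site d) (a : Fin (M + 2) → Fin 3 ⊕ Unit) (c : Fin 3 ⊕ Unit) (b : Fin (M + 2) → Site d × Site d)
      (w t z : Fin (M + 2) → Site d),
      ∀ κ : Fin (M + 2) → Fin d × Bool, (∀ i, (b i).2 = (b i).1 + stepVec (κ i)) →
      ∀ τ : Fin (M + 1) → Bool × Fin 3, AdmT M a τ →
      ∀ a₀ a' : Fin 3, a (0 : Fin (M + 1)).castSucc = Sum.inl a₀ → a (0 : Fin (M + 1)).succ = Sum.inl a' →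
      τ 0 = (true, 0) → a' = 2 → t (0 : Fin (M + 1)).castSucc ≠ (b (0 : Fin (M + 1)).succ).1 →
      z (0 : Fin (M + 1)).castSucc = t (0 : Fin (M + 1)).castSucc →
      (zdGraph d).Adj (w (0 : Fin (M + 1)).succ) (t (0 : Fin (M + 1)).castSucc) →
      Nonempty (JPkg p (jctx M x b w t z a τ (0 : Fin (M + 1)).castSucc) (JFacts M x b w t z a c τ)
        (blockPS (Letters.perc d p) a₀ (b (0 : Fin (M + 1)).castSucc).1 (w (0 : Fin (M + 1)).castSucc) *
          tgtRegS (Letters.perc d p) (κ (0 : Fin (M + 1)).castSucc) a₀ a' (b (0 : Fin (M + 1)).castSucc).1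
            (w (0 : Fin (M + 1)).castSucc) (t (0 : Fin (M + 1)).castSucc) (z (0 : Fin (M + 1)).castSucc)
            (w (0 : Fin (M + 1)).succ) (b (0 : Fin (M + 1)).succ).1 (τ 0))))
    (hR' : ∀ (x : Site d) (a : Fin (M + 2) → Fin 3 ⊕ Unit) (c : Fin 3 ⊕ Unit) (b : Fin (M + 2) → Site d × Site d)
      (w t z : Fin (M + 2) → Site d),
      ∀ κ : Fin (M + 2) → Fin d × Bool, (∀ i, (b i).2 = (b i).1 + stepVec (κ i)) →
      ∀ τ : Fin (M + 1) → Bool × Fin 3, AdmT M a τ →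
      ∀ i i₀ : Fin (M + 1), i₀.succ = i.castSucc → ∀ a₀ a' : Fin 3, a i.castSucc = Sum.inl a₀ →
      a i.succ = Sum.inl a' → (τ i).1 = false → a' ≠ 0 → w i.succ = t i.castSucc →
      Nonempty (JPkg p (jctx M x b w t z a τ i.castSucc) (JFacts M x b w t z a c τ)
        (tgtRegS (Letters.perc d p) (κ i.castSucc) a₀ a' (b i.castSucc).1 (w i.castSucc) (t i.castSucc) (z i.castSucc)
          (w i.succ) (b i.succ).1 (τ i))))
    (hR : ∀ (x : Site d) (a : Fin (M + 2) → Fin 3 ⊕ Unit) (c : Fin 3 ⊕ Unit) (b : Fin (M + 2) → Site d × Site d)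
      (w t z : Fin (M + 2) → Site d),
      ∀ κ : Fin (M + 2) → Fin d × Bool, (∀ i, (b i).2 = (b i).1 + stepVec (κ i)) →
      ∀ τ : Fin (M + 1) → Bool × Fin 3, AdmT M a τ →
      ∀ i i₀ : Fin (M + 1), i₀.succ = i.castSucc → ∀ a₀ a' : Fin 3, a i.castSucc = Sum.inl a₀ →
      a i.succ = Sum.inl a' → τ i = (true, 0) → a' = 2 → t i.castSucc ≠ (b i.succ).1 →
      z i.castSucc = t i.castSucc → (zdGraph d).Adj (w i.succ) (t i.castSucc) →
      Nonempty (JPkg p (jctx M x b w t z a τ i.castSucc) (JFacts M x b w t z a c τ)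
        (tgtRegS (Letters.perc d p) (κ i.castSucc) a₀ a' (b i.castSucc).1 (w i.castSucc) (t i.castSucc) (z i.castSucc)
          (w i.succ) (b i.succ).1 (τ i))))
    (hR'L : ∀ (x : Site d) (a : Fin (M + 2) → Fin 3 ⊕ Unit) (c : Fin 3 ⊕ Unit) (b : Fin (M + 2) → Site d × Site d)
      (w t z : Fin (M + 2) → Site d),
      ∀ κ : Fin (M + 2) → Fin d × Bool, (∀ i, (b i).2 = (b i).1 + stepVec (κ i)) →
      ∀ τ : Fin (M + 1) → Bool × Fin 3, AdmT M a τ →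
      ∀ i i₀ : Fin (M + 1), i₀.succ = i.castSucc → ∀ (u₀ : Unit) (a' : Fin 3), a i.castSucc = Sum.inr u₀ →
      a i.succ = Sum.inl a' → (τ i).1 = false → a' ≠ 0 → w i.succ = t i.castSucc →
      Nonempty (JPkg p (jctx M x b w t z a τ i.castSucc) (JFacts M x b w t z a c τ)
        (tgtStarLS (Letters.perc d p) (κ i.castSucc) a' (b i.castSucc).1 (w i.castSucc) (t i.castSucc) (z i.castSucc)
          (w i.succ) (b i.succ).1 (τ i))))
    (hRL : ∀ (x : Site d) (a : Fin (M + 2) → Fin 3 ⊕ Unit) (c : Fin 3 ⊕ Unit) (b : Fin (M + 2) → Site d × Site d)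
      (w t z : Fin (M + 2) → Site d),
      ∀ κ : Fin (M + 2) → Fin d × Bool, (∀ i, (b i).2 = (b i).1 + stepVec (κ i)) →
      ∀ τ : Fin (M + 1) → Bool × Fin 3, AdmT M a τ →
      ∀ i i₀ : Fin (M + 1), i₀.succ = i.castSucc → ∀ (u₀ : Unit) (a' : Fin 3), a i.castSucc = Sum.inr u₀ →
      a i.succ = Sum.inl a' → (τ i).1 = true → (τ i).2 = 0 → a' = 2 → t i.castSucc ≠ (b i.succ).1 →
      z i.castSucc = t i.castSucc → z i.castSucc = w i.castSucc → (zdGraph d).Adj (w i.succ) (t i.castSucc) →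
      Nonempty (JPkg p (jctx M x b w t z a τ i.castSucc) (JFacts M x b w t z a c τ)
        (tgtStarLS (Letters.perc d p) (κ i.castSucc) a' (b i.castSucc).1 (w i.castSucc) (t i.castSucc) (z i.castSucc)
          (w i.succ) (b i.succ).1 (τ i)))) :
    ∑' x, nobleXiT d p (M + 2) x ≤
      vecP (starS (blockPS (Letters.perc d p))) ᵥ*
        matB (starB (blockBFullB' (Letters.perc d p) (blockX₂Sharp (Letters.perc d p)))
          (secEc (blockBFullpt' (Letters.perc d p) (blockXSharp (Letters.perc d p))) 0)
          (secEo (blockBFullpt' (Letters.perc d p) (blockXSharp (Letters.perc d p))) 2)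
          (secEoc (blockBFullpt' (Letters.perc d p) (blockXSharp (Letters.perc d p))) 2 0)) ^ (M + 1) ᵥ*
          matAbar (starA (blockAbar' (Letters.perc d p)) (secEA (blockAbar' (Letters.perc d p)) 2)) ⬝ᵥ
        vecP (starS (blockPE (Letters.perc d p))) :=
  tsum_nobleXiT_le_secStarBSharp_of_pairPackages p M
    (fun x a c b w t z κ hκ τ hτ a₀ a' ha ha' => nonempty_jPkg_first_regS p M x b w t z a c τ (κ _) (hκ _) a₀ a' ha ha'
      (hR'₀ x a c b w t z κ hκ τ hτ a₀ a' ha ha') (hR₀ x a c b w t z κ hκ τ hτ a₀ a' ha ha'))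
    (fun x a c b w t z κ hκ τ hτ i i₀ hk a₀ a' ha ha' => nonempty_jPkg_mid_regS p M x b w t z a c τ i i₀ hk (κ _) (hκ _)
      a₀ a' ha ha' (hR' x a c b w t z κ hκ τ hτ i i₀ hk a₀ a' ha ha') (hR x a c b w t z κ hκ τ hτ i i₀ hk a₀ a' ha ha'))
    fun x a c b w t z κ hκ τ hτ i i₀ hk u₀ a' ha ha' => nonempty_jPkg_mid_starLS p M x b w t z a c τ i i₀ hk (κ _) (hκ _)
      ha a' ha' (hR'L x a c b w t z κ hκ τ hτ i i₀ hk u₀ a' ha ha') (hRL x a c b w t z κ hκ τ hτ i i₀ hk u₀ a' ha ha')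

end SizeModelS

end Summit.CriticalPhenomena.LaceExpansionHighD.NobleBlocks

end
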